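import Summits.CriticalPhenomena.PercolationContinuityZ3.Theorems.PercNearOneGluingNoHeavyLowerTailThreePartitionVOrderPrincipal

/-!
# THEOREM Π (principal up-sets, ARBITRARY twist): the `E₃` face kernel with a monotone 2-increasing weight, summed over all
# faces above a face of the TWISTED copy order, is `≥ 0`

Support file (lineage `prim-bnk-2`, generation 33; `--supports stmt-CriticalPhenomena-4575`; memo
`run/shared/lean/prim/prim-l12/FROM-prim-bnk-2-g33-CONJ-W.md` §3f).  No `sorry`, no new definitions, standard axioms.
In COPY coordinates `(a,b,c)` the kernel of Conjecture V/W is `K_Z(a,b,c) = 2Z(a,a) + Z(c,b) − Z(c,a) − Z(a,c) − Z(c,c)`; under a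
twist an untwisted coordinate lies in one copy, a twisted one in two, and the copy order is `a ⊆ a'`, `b ⊆ b'`.  The faces above
`(a₀,b₀)` are `a = A ∪ g ∪ s`, `b = B ∪ h ∪ t`, `c = w ∪ (XZ \ s) ∪ (YZ \ t)` with `(g,h,w)` the 3-partitions of the untwisted free
coordinates `z₀`, `s ⊆ XZ` (twisted coordinates of `b₀ \ a₀`), `t ⊆ YZ` (twisted coordinates of `a₀ \ b₀`), `A = a₀ ⊇ YZ`,
`B = b₀ ⊇ XZ` (checked against the twisted face sum: `code/g33/twisted_param_check.py`).  **THEOREM Π**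
(`twistedPrincipal_kernelZ_sum_nonneg`): for `Z` monotone in each argument and 2-increasing and `YZ ⊆ A`, `XZ ⊆ B`, the sum of `K_Z`
over these faces is `≥ 0` (`XZ = YZ = ∅`: THEOREM P⊗).  Hence Conjecture V holds on every principal up-set of every twisted copy order
for ALL up-sets `𝒱, 𝒲`, and the comb coefficient of a principal filter is `≥ 0` at every profile.  PROOF: `K = α + β`,
`α = Z(a,a) − Z(c,c)`, `β = Z(a,a) − Z(a,c) − Z(c,a) + Z(c,b)`; nested inductions over `YZ` (one re-indexing `t ↦ YZ \ t`), `XZ`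
(`K`-pair `= K_Z + K_{Z(·∪e,·∪e)} +` two mixed differences) and `z₀` (the identities of THEOREM P), all TERMWISE. [this work]
-/

namespace Summit.CriticalPhenomena.PercolationContinuityZ3.Theorems.ThreePartition

open Finset

variable {ι : Type*} [DecidableEq ι]

/-! ## Re-indexing by complements inside a powerset -/

/-- `Σ_{t ⊆ Y} f (Y \ t) = Σ_{t ⊆ Y} f t`. [this work] -/
theorem sum_powerset_sdiff_reindex (Y : Finset ι) (f : Finset ι → ℤ) :
    ∑ t ∈ Y.powerset, f (Y \ t) = ∑ t ∈ Y.powerset, f t := by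
  refine Finset.sum_bij' (fun t _ => Y \ t) (fun t _ => Y \ t) ?_ ?_ ?_ ?_ ?_
  · intro t _; exact Finset.mem_powerset.2 Finset.sdiff_subset
  · intro t _; exact Finset.mem_powerset.2 Finset.sdiff_subset
  · intro t ht; exact Finset.sdiff_sdiff_eq_self (Finset.mem_powerset.1 ht)
  · intro t ht; exact Finset.sdiff_sdiff_eq_self (Finset.mem_powerset.1 ht)
  · intro t _; rfl

/-! ## The innermost sums: twisted coordinates that may join `b` (`YZ`) -/

/-- `α`-part, `YZ` only: `Σ_{t ⊆ YZ} (Z(A,A) − Z(YZ\t, YZ\t)) ≥ 0` for `Z` monotone and `YZ ⊆ A`. [this work] -/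
theorem twistedBase_alpha_nonneg (Z : Finset ι → Finset ι → ℤ)
    (hl : ∀ S S' T, S ⊆ S' → Z S T ≤ Z S' T) (hr : ∀ S T T', T ⊆ T' → Z S T ≤ Z S T')
    (A YZ : Finset ι) (hYA : YZ ⊆ A) :
    0 ≤ ∑ t ∈ YZ.powerset, (Z A A - Z (YZ \ t) (YZ \ t)) := by
  refine Finset.sum_nonneg fun t _ => ?_
  have h1 : YZ \ t ⊆ A := Finset.sdiff_subset.trans hYA
  have := hl _ _ (YZ \ t) h1
  have := hr A _ _ h1
  linarith

/-- `β`-part, `YZ` only: `Σ_{t ⊆ YZ} (Z(A,A) − Z(A,c) − Z(c,A) + Z(c, B ∪ t)) ≥ 0`, `c = YZ \ t`, for `Z` monotone 2-increasing and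
`YZ ⊆ A` (after re-indexing `t ↦ YZ \ t` in two of the four terms every summand is a mixed difference plus an increment). [this work] -/
theorem twistedBase_beta_nonneg (Z : Finset ι → Finset ι → ℤ)
    (hr : ∀ S T T', T ⊆ T' → Z S T ≤ Z S T')
    (hm : ∀ S S' T T', S ⊆ S' → T ⊆ T' → Z S' T + Z S T' ≤ Z S' T' + Z S T)
    (A B YZ : Finset ι) (hYA : YZ ⊆ A) :
    0 ≤ ∑ t ∈ YZ.powerset, (Z A A - Z A (YZ \ t) - Z (YZ \ t) A + Z (YZ \ t) (B ∪ t)) := by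
  have r1 : ∑ t ∈ YZ.powerset, Z (YZ \ t) A = ∑ t ∈ YZ.powerset, Z t A :=
    sum_powerset_sdiff_reindex YZ (fun t => Z t A)
  have r2 : ∑ t ∈ YZ.powerset, Z (YZ \ t) (B ∪ t) = ∑ t ∈ YZ.powerset, Z t (B ∪ (YZ \ t)) := by
    have h := sum_powerset_sdiff_reindex YZ (fun t => Z t (B ∪ (YZ \ t)))
    rw [← h]
    refine Finset.sum_congr rfl fun t ht => ?_
    rw [Finset.sdiff_sdiff_eq_self (Finset.mem_powerset.1 ht)]
  have hsplit : ∑ t ∈ YZ.powerset, (Z A A - Z A (YZ \ t) - Z (YZ \ t) A + Z (YZ \ t) (B ∪ t)) =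
      ∑ t ∈ YZ.powerset, (Z A A - Z A (YZ \ t)) - ∑ t ∈ YZ.powerset, Z (YZ \ t) A
        + ∑ t ∈ YZ.powerset, Z (YZ \ t) (B ∪ t) := by
    rw [← Finset.sum_sub_distrib, ← Finset.sum_add_distrib]
  rw [hsplit, r1, r2, ← Finset.sum_sub_distrib, ← Finset.sum_add_distrib]
  refine Finset.sum_nonneg fun t ht => ?_
  have htY : t ⊆ YZ := Finset.mem_powerset.1 ht
  have h1 := hm t A (YZ \ t) A (htY.trans hYA) (Finset.sdiff_subset.trans hYA)
  have h2 := hr t (YZ \ t) (B ∪ (YZ \ t)) Finset.subset_union_right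
  linarith

/-! ## Induction over the twisted coordinates that may join `a` (`XZ`) -/

/-- `α`-part over `XZ × YZ`. [this work] -/
theorem twistedBase2_alpha_nonneg (XZ : Finset ι) :
    ∀ (Z : Finset ι → Finset ι → ℤ), (∀ S S' T, S ⊆ S' → Z S T ≤ Z S' T) → (∀ S T T', T ⊆ T' → Z S T ≤ Z S T') →
      ∀ (A YZ : Finset ι), YZ ⊆ A →
      0 ≤ ∑ s ∈ XZ.powerset, ∑ t ∈ YZ.powerset, (Z (A ∪ s) (A ∪ s) - Z ((XZ \ s) ∪ (YZ \ t)) ((XZ \ s) ∪ (YZ \ t))) := by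
  induction XZ using Finset.induction_on with
  | empty =>
    intro Z hl hr A YZ hYA
    simp only [Finset.powerset_empty, Finset.sum_singleton, Finset.union_empty, Finset.empty_sdiff, Finset.empty_union]
    exact twistedBase_alpha_nonneg Z hl hr A YZ hYA
  | insert e XZ he ih =>
    intro Z hl hr A YZ hYA
    rw [Finset.sum_powerset_insert he]
    have hl1 : ∀ S S' T : Finset ι, S ⊆ S' → Z (insert e S) (insert e T) ≤ Z (insert e S') (insert e T) :=
      fun S S' T hST => hl _ _ _ (Finset.insert_subset_insert e hST)
    have hr1 : ∀ S T T' : Finset ι, T ⊆ T' → Z (insert e S) (insert e T) ≤ Z (insert e S) (insert e T') :=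
      fun S T T' hT => hr _ _ _ (Finset.insert_subset_insert e hT)
    have k0 := ih Z hl hr A YZ hYA
    have k1 := ih (fun S T => Z (insert e S) (insert e T)) hl1 hr1 A YZ hYA
    have e1 : ∑ s ∈ XZ.powerset, ∑ t ∈ YZ.powerset,
        (Z (A ∪ s) (A ∪ s) - Z ((insert e XZ \ s) ∪ (YZ \ t)) ((insert e XZ \ s) ∪ (YZ \ t))) =
        ∑ s ∈ XZ.powerset, ∑ t ∈ YZ.powerset,
          (Z (A ∪ s) (A ∪ s) - Z (insert e ((XZ \ s) ∪ (YZ \ t))) (insert e ((XZ \ s) ∪ (YZ \ t)))) := by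
      refine Finset.sum_congr rfl fun s hs => Finset.sum_congr rfl fun t _ => ?_
      have hes : e ∉ s := fun h => he (Finset.mem_powerset.1 hs h)
      rw [Finset.insert_sdiff_of_notMem XZ hes, Finset.insert_union]
    have e2 : ∑ s ∈ XZ.powerset, ∑ t ∈ YZ.powerset,
        (Z (A ∪ insert e s) (A ∪ insert e s) - Z ((insert e XZ \ insert e s) ∪ (YZ \ t)) ((insert e XZ \ insert e s) ∪ (YZ \ t))) =
        ∑ s ∈ XZ.powerset, ∑ t ∈ YZ.powerset,
          (Z (insert e (A ∪ s)) (insert e (A ∪ s)) - Z ((XZ \ s) ∪ (YZ \ t)) ((XZ \ s) ∪ (YZ \ t))) := by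
      refine Finset.sum_congr rfl fun s _ => Finset.sum_congr rfl fun t _ => ?_
      rw [Finset.insert_sdiff_insert, Finset.sdiff_insert_of_notMem he, Finset.union_insert]
    rw [e1, e2]
    have hsum : ∑ s ∈ XZ.powerset, ∑ t ∈ YZ.powerset,
          (Z (A ∪ s) (A ∪ s) - Z (insert e ((XZ \ s) ∪ (YZ \ t))) (insert e ((XZ \ s) ∪ (YZ \ t)))) +
        ∑ s ∈ XZ.powerset, ∑ t ∈ YZ.powerset,
          (Z (insert e (A ∪ s)) (insert e (A ∪ s)) - Z ((XZ \ s) ∪ (YZ \ t)) ((XZ \ s) ∪ (YZ \ t))) =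
        ∑ s ∈ XZ.powerset, ∑ t ∈ YZ.powerset,
          (Z (insert e (A ∪ s)) (insert e (A ∪ s)) - Z (insert e ((XZ \ s) ∪ (YZ \ t))) (insert e ((XZ \ s) ∪ (YZ \ t)))) +
        ∑ s ∈ XZ.powerset, ∑ t ∈ YZ.powerset,
          (Z (A ∪ s) (A ∪ s) - Z ((XZ \ s) ∪ (YZ \ t)) ((XZ \ s) ∪ (YZ \ t))) := by
      rw [← Finset.sum_add_distrib, ← Finset.sum_add_distrib]
      refine Finset.sum_congr rfl fun s _ => ?_
      rw [← Finset.sum_add_distrib, ← Finset.sum_add_distrib]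
      refine Finset.sum_congr rfl fun t _ => ?_
      ring
    rw [hsum]
    exact add_nonneg k1 k0

/-- `β`-part over `XZ × YZ` (needs `XZ ⊆ B`: the `XZ`-coordinates always lie in copy `b`).  Step identity per summand:
`β(a, b, c+e) + β(a+e, b, c) = β_Z(a,b,c) + β_{Z(·+e,·+e)}(a, b∖e, c) + [mixed difference at (a,c)] + [mixed difference at (c,a)]`. [this work] -/
theorem twistedBase2_beta_nonneg (XZ : Finset ι) :
    ∀ (Z : Finset ι → Finset ι → ℤ), (∀ S S' T, S ⊆ S' → Z S T ≤ Z S' T) → (∀ S T T', T ⊆ T' → Z S T ≤ Z S T') →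
      (∀ S S' T T', S ⊆ S' → T ⊆ T' → Z S' T + Z S T' ≤ Z S' T' + Z S T) →
      ∀ (A B YZ : Finset ι), YZ ⊆ A → XZ ⊆ B →
      0 ≤ ∑ s ∈ XZ.powerset, ∑ t ∈ YZ.powerset,
        (Z (A ∪ s) (A ∪ s) - Z (A ∪ s) ((XZ \ s) ∪ (YZ \ t)) - Z ((XZ \ s) ∪ (YZ \ t)) (A ∪ s)
          + Z ((XZ \ s) ∪ (YZ \ t)) (B ∪ t)) := by
  induction XZ using Finset.induction_on with
  | empty =>
    intro Z hl hr hm A B YZ hYA _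
    simp only [Finset.powerset_empty, Finset.sum_singleton, Finset.union_empty, Finset.empty_sdiff, Finset.empty_union]
    exact twistedBase_beta_nonneg Z hr hm A B YZ hYA
  | insert e XZ he ih =>
    intro Z hl hr hm A B YZ hYA hXB
    have heB : e ∈ B := hXB (Finset.mem_insert_self e XZ)
    have hXB' : XZ ⊆ B.erase e := fun i hi =>
      Finset.mem_erase.2 ⟨fun h => he (h ▸ hi), hXB (Finset.mem_insert_of_mem hi)⟩
    rw [Finset.sum_powerset_insert he]
    have hl1 : ∀ S S' T : Finset ι, S ⊆ S' → Z (insert e S) (insert e T) ≤ Z (insert e S') (insert e T) :=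
      fun S S' T hST => hl _ _ _ (Finset.insert_subset_insert e hST)
    have hr1 : ∀ S T T' : Finset ι, T ⊆ T' → Z (insert e S) (insert e T) ≤ Z (insert e S) (insert e T') :=
      fun S T T' hT => hr _ _ _ (Finset.insert_subset_insert e hT)
    have hm1 : ∀ S S' T T' : Finset ι, S ⊆ S' → T ⊆ T' →
        Z (insert e S') (insert e T) + Z (insert e S) (insert e T') ≤ Z (insert e S') (insert e T') + Z (insert e S) (insert e T) :=
      fun S S' T T' hS hT => hm _ _ _ _ (Finset.insert_subset_insert e hS) (Finset.insert_subset_insert e hT)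
    have k0 := ih Z hl hr hm A B YZ hYA (fun i hi => hXB (Finset.mem_insert_of_mem hi))
    have k1 := ih (fun S T => Z (insert e S) (insert e T)) hl1 hr1 hm1 A (B.erase e) YZ hYA hXB'
    have e1 : ∑ s ∈ XZ.powerset, ∑ t ∈ YZ.powerset,
        (Z (A ∪ s) (A ∪ s) - Z (A ∪ s) ((insert e XZ \ s) ∪ (YZ \ t)) - Z ((insert e XZ \ s) ∪ (YZ \ t)) (A ∪ s)
          + Z ((insert e XZ \ s) ∪ (YZ \ t)) (B ∪ t)) =
        ∑ s ∈ XZ.powerset, ∑ t ∈ YZ.powerset,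
          (Z (A ∪ s) (A ∪ s) - Z (A ∪ s) (insert e ((XZ \ s) ∪ (YZ \ t)))
            - Z (insert e ((XZ \ s) ∪ (YZ \ t))) (A ∪ s) + Z (insert e ((XZ \ s) ∪ (YZ \ t))) (B ∪ t)) := by
      refine Finset.sum_congr rfl fun s hs => Finset.sum_congr rfl fun t _ => ?_
      have hes : e ∉ s := fun h => he (Finset.mem_powerset.1 hs h)
      rw [Finset.insert_sdiff_of_notMem XZ hes, Finset.insert_union]
    have e2 : ∑ s ∈ XZ.powerset, ∑ t ∈ YZ.powerset,
        (Z (A ∪ insert e s) (A ∪ insert e s) - Z (A ∪ insert e s) ((insert e XZ \ insert e s) ∪ (YZ \ t))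
          - Z ((insert e XZ \ insert e s) ∪ (YZ \ t)) (A ∪ insert e s) + Z ((insert e XZ \ insert e s) ∪ (YZ \ t)) (B ∪ t)) =
        ∑ s ∈ XZ.powerset, ∑ t ∈ YZ.powerset,
          (Z (insert e (A ∪ s)) (insert e (A ∪ s)) - Z (insert e (A ∪ s)) ((XZ \ s) ∪ (YZ \ t))
            - Z ((XZ \ s) ∪ (YZ \ t)) (insert e (A ∪ s)) + Z ((XZ \ s) ∪ (YZ \ t)) (B ∪ t)) := by
      refine Finset.sum_congr rfl fun s _ => Finset.sum_congr rfl fun t _ => ?_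
      rw [Finset.insert_sdiff_insert, Finset.sdiff_insert_of_notMem he, Finset.union_insert]
    have k1' : 0 ≤ ∑ s ∈ XZ.powerset, ∑ t ∈ YZ.powerset,
        (Z (insert e (A ∪ s)) (insert e (A ∪ s)) - Z (insert e (A ∪ s)) (insert e ((XZ \ s) ∪ (YZ \ t)))
          - Z (insert e ((XZ \ s) ∪ (YZ \ t))) (insert e (A ∪ s)) + Z (insert e ((XZ \ s) ∪ (YZ \ t))) (B ∪ t)) := by
      refine le_trans k1 (le_of_eq ?_)
      refine Finset.sum_congr rfl fun s _ => Finset.sum_congr rfl fun t _ => ?_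
      have hb : insert e (B.erase e ∪ t) = B ∪ t := by rw [← Finset.insert_union, Finset.insert_erase heB]
      rw [hb]
    have kmix : 0 ≤ ∑ s ∈ XZ.powerset, ∑ t ∈ YZ.powerset,
        ((Z (insert e (A ∪ s)) (insert e ((XZ \ s) ∪ (YZ \ t))) - Z (A ∪ s) (insert e ((XZ \ s) ∪ (YZ \ t)))
            - Z (insert e (A ∪ s)) ((XZ \ s) ∪ (YZ \ t)) + Z (A ∪ s) ((XZ \ s) ∪ (YZ \ t))) +
          (Z (insert e ((XZ \ s) ∪ (YZ \ t))) (insert e (A ∪ s)) - Z ((XZ \ s) ∪ (YZ \ t)) (insert e (A ∪ s))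
            - Z (insert e ((XZ \ s) ∪ (YZ \ t))) (A ∪ s) + Z ((XZ \ s) ∪ (YZ \ t)) (A ∪ s))) := by
      refine Finset.sum_nonneg fun s _ => Finset.sum_nonneg fun t _ => add_nonneg ?_ ?_
      · have := hm (A ∪ s) (insert e (A ∪ s)) ((XZ \ s) ∪ (YZ \ t)) (insert e ((XZ \ s) ∪ (YZ \ t)))
          (Finset.subset_insert e _) (Finset.subset_insert e _)
        linarith
      · have := hm ((XZ \ s) ∪ (YZ \ t)) (insert e ((XZ \ s) ∪ (YZ \ t))) (A ∪ s) (insert e (A ∪ s))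
          (Finset.subset_insert e _) (Finset.subset_insert e _)
        linarith
    rw [e1, e2]
    have hsum : ∑ s ∈ XZ.powerset, ∑ t ∈ YZ.powerset,
          (Z (A ∪ s) (A ∪ s) - Z (A ∪ s) (insert e ((XZ \ s) ∪ (YZ \ t)))
            - Z (insert e ((XZ \ s) ∪ (YZ \ t))) (A ∪ s) + Z (insert e ((XZ \ s) ∪ (YZ \ t))) (B ∪ t)) +
        ∑ s ∈ XZ.powerset, ∑ t ∈ YZ.powerset,
          (Z (insert e (A ∪ s)) (insert e (A ∪ s)) - Z (insert e (A ∪ s)) ((XZ \ s) ∪ (YZ \ t))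
            - Z ((XZ \ s) ∪ (YZ \ t)) (insert e (A ∪ s)) + Z ((XZ \ s) ∪ (YZ \ t)) (B ∪ t)) =
        (∑ s ∈ XZ.powerset, ∑ t ∈ YZ.powerset,
          (Z (A ∪ s) (A ∪ s) - Z (A ∪ s) ((XZ \ s) ∪ (YZ \ t)) - Z ((XZ \ s) ∪ (YZ \ t)) (A ∪ s)
            + Z ((XZ \ s) ∪ (YZ \ t)) (B ∪ t))) +
        (∑ s ∈ XZ.powerset, ∑ t ∈ YZ.powerset,
          (Z (insert e (A ∪ s)) (insert e (A ∪ s)) - Z (insert e (A ∪ s)) (insert e ((XZ \ s) ∪ (YZ \ t)))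
            - Z (insert e ((XZ \ s) ∪ (YZ \ t))) (insert e (A ∪ s)) + Z (insert e ((XZ \ s) ∪ (YZ \ t))) (B ∪ t))) +
        ∑ s ∈ XZ.powerset, ∑ t ∈ YZ.powerset,
          ((Z (insert e (A ∪ s)) (insert e ((XZ \ s) ∪ (YZ \ t))) - Z (A ∪ s) (insert e ((XZ \ s) ∪ (YZ \ t)))
              - Z (insert e (A ∪ s)) ((XZ \ s) ∪ (YZ \ t)) + Z (A ∪ s) ((XZ \ s) ∪ (YZ \ t))) +
            (Z (insert e ((XZ \ s) ∪ (YZ \ t))) (insert e (A ∪ s)) - Z ((XZ \ s) ∪ (YZ \ t)) (insert e (A ∪ s))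
              - Z (insert e ((XZ \ s) ∪ (YZ \ t))) (A ∪ s) + Z ((XZ \ s) ∪ (YZ \ t)) (A ∪ s))) := by
      rw [← Finset.sum_add_distrib, ← Finset.sum_add_distrib, ← Finset.sum_add_distrib]
      refine Finset.sum_congr rfl fun s _ => ?_
      rw [← Finset.sum_add_distrib, ← Finset.sum_add_distrib, ← Finset.sum_add_distrib]
      refine Finset.sum_congr rfl fun t _ => ?_
      ring
    rw [hsum]
    exact add_nonneg (add_nonneg k0 k1') kmix

/-! ## Induction over the untwisted free coordinates `z₀` -/

/-- `α`-part, full parametrisation. [this work] -/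
theorem twistedPrincipal_alpha_nonneg (z₀ : Finset ι) :
    ∀ (Z : Finset ι → Finset ι → ℤ), (∀ S S' T, S ⊆ S' → Z S T ≤ Z S' T) → (∀ S T T', T ⊆ T' → Z S T ≤ Z S T') →
      ∀ (A XZ YZ : Finset ι), YZ ⊆ A →
      0 ≤ ∑ g ∈ z₀.powerset, ∑ h ∈ (z₀ \ g).powerset, ∑ s ∈ XZ.powerset, ∑ t ∈ YZ.powerset,
        (Z (A ∪ g ∪ s) (A ∪ g ∪ s)
          - Z (((z₀ \ g) \ h) ∪ (XZ \ s) ∪ (YZ \ t)) (((z₀ \ g) \ h) ∪ (XZ \ s) ∪ (YZ \ t))) := by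
  induction z₀ using Finset.induction_on with
  | empty =>
    intro Z hl hr A XZ YZ hYA
    simp only [Finset.powerset_empty, Finset.sum_singleton, Finset.empty_sdiff, Finset.union_empty, Finset.empty_union]
    exact twistedBase2_alpha_nonneg XZ Z hl hr A YZ hYA
  | insert e z₀ he ih =>
    intro Z hl hr A XZ YZ hYA
    have h3 := sum_threePartitions_insert he (fun g h w => ∑ s ∈ XZ.powerset, ∑ t ∈ YZ.powerset,
      (Z (A ∪ g ∪ s) (A ∪ g ∪ s) - Z (w ∪ (XZ \ s) ∪ (YZ \ t)) (w ∪ (XZ \ s) ∪ (YZ \ t))))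
    rw [h3]
    have hl1 : ∀ S S' T : Finset ι, S ⊆ S' → Z (insert e S) (insert e T) ≤ Z (insert e S') (insert e T) :=
      fun S S' T hST => hl _ _ _ (Finset.insert_subset_insert e hST)
    have hr1 : ∀ S T T' : Finset ι, T ⊆ T' → Z (insert e S) (insert e T) ≤ Z (insert e S) (insert e T') :=
      fun S T T' hT => hr _ _ _ (Finset.insert_subset_insert e hT)
    have hYA' : YZ ⊆ insert e A := hYA.trans (Finset.subset_insert e A)
    have key := ih (fun S T => Z (insert e S) (insert e T)) hl1 hr1 A XZ YZ hYA
    have key2 := ih Z hl hr A XZ YZ hYA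
    have hsplit : ∑ g ∈ z₀.powerset, ∑ h ∈ (z₀ \ g).powerset,
        ((∑ s ∈ XZ.powerset, ∑ t ∈ YZ.powerset,
            (Z (A ∪ insert e g ∪ s) (A ∪ insert e g ∪ s)
              - Z ((z₀ \ g) \ h ∪ (XZ \ s) ∪ (YZ \ t)) ((z₀ \ g) \ h ∪ (XZ \ s) ∪ (YZ \ t)))) +
          (∑ s ∈ XZ.powerset, ∑ t ∈ YZ.powerset,
            (Z (A ∪ g ∪ s) (A ∪ g ∪ s) - Z ((z₀ \ g) \ h ∪ (XZ \ s) ∪ (YZ \ t)) ((z₀ \ g) \ h ∪ (XZ \ s) ∪ (YZ \ t)))) +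
          (∑ s ∈ XZ.powerset, ∑ t ∈ YZ.powerset,
            (Z (A ∪ g ∪ s) (A ∪ g ∪ s)
              - Z (insert e ((z₀ \ g) \ h) ∪ (XZ \ s) ∪ (YZ \ t)) (insert e ((z₀ \ g) \ h) ∪ (XZ \ s) ∪ (YZ \ t))))) =
        (∑ g ∈ z₀.powerset, ∑ h ∈ (z₀ \ g).powerset, ∑ s ∈ XZ.powerset, ∑ t ∈ YZ.powerset,
          (Z (insert e (A ∪ g ∪ s)) (insert e (A ∪ g ∪ s))
            - Z (insert e ((z₀ \ g) \ h ∪ (XZ \ s) ∪ (YZ \ t))) (insert e ((z₀ \ g) \ h ∪ (XZ \ s) ∪ (YZ \ t))))) +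
        2 * ∑ g ∈ z₀.powerset, ∑ h ∈ (z₀ \ g).powerset, ∑ s ∈ XZ.powerset, ∑ t ∈ YZ.powerset,
          (Z (A ∪ g ∪ s) (A ∪ g ∪ s) - Z ((z₀ \ g) \ h ∪ (XZ \ s) ∪ (YZ \ t)) ((z₀ \ g) \ h ∪ (XZ \ s) ∪ (YZ \ t))) := by
      rw [Finset.mul_sum, ← Finset.sum_add_distrib]
      refine Finset.sum_congr rfl fun g _ => ?_
      rw [Finset.mul_sum, ← Finset.sum_add_distrib]
      refine Finset.sum_congr rfl fun h _ => ?_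
      rw [Finset.mul_sum, ← Finset.sum_add_distrib, ← Finset.sum_add_distrib, ← Finset.sum_add_distrib]
      refine Finset.sum_congr rfl fun s _ => ?_
      rw [Finset.mul_sum, ← Finset.sum_add_distrib, ← Finset.sum_add_distrib, ← Finset.sum_add_distrib]
      refine Finset.sum_congr rfl fun t _ => ?_
      rw [Finset.union_insert, Finset.insert_union, Finset.insert_union, Finset.insert_union]
      ring
    rw [hsplit]
    nlinarith [key, key2]

/-- `β`-part, full parametrisation (termwise slicing identity of THEOREM P in the free coordinate `e`). [this work] -/
theorem twistedPrincipal_beta_nonneg (z₀ : Finset ι) :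
    ∀ (Z : Finset ι → Finset ι → ℤ), (∀ S S' T, S ⊆ S' → Z S T ≤ Z S' T) → (∀ S T T', T ⊆ T' → Z S T ≤ Z S T') →
      (∀ S S' T T', S ⊆ S' → T ⊆ T' → Z S' T + Z S T' ≤ Z S' T' + Z S T) →
      ∀ (A B XZ YZ : Finset ι), YZ ⊆ A → XZ ⊆ B →
      0 ≤ ∑ g ∈ z₀.powerset, ∑ h ∈ (z₀ \ g).powerset, ∑ s ∈ XZ.powerset, ∑ t ∈ YZ.powerset,
        (Z (A ∪ g ∪ s) (A ∪ g ∪ s) - Z (A ∪ g ∪ s) (((z₀ \ g) \ h) ∪ (XZ \ s) ∪ (YZ \ t))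
          - Z (((z₀ \ g) \ h) ∪ (XZ \ s) ∪ (YZ \ t)) (A ∪ g ∪ s)
          + Z (((z₀ \ g) \ h) ∪ (XZ \ s) ∪ (YZ \ t)) (B ∪ h ∪ t)) := by
  induction z₀ using Finset.induction_on with
  | empty =>
    intro Z hl hr hm A B XZ YZ hYA hXB
    simp only [Finset.powerset_empty, Finset.sum_singleton, Finset.empty_sdiff, Finset.union_empty, Finset.empty_union]
    exact twistedBase2_beta_nonneg XZ Z hl hr hm A B YZ hYA hXB
  | insert e z₀ he ih =>
    intro Z hl hr hm A B XZ YZ hYA hXB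
    have h3 := sum_threePartitions_insert he (fun g h w => ∑ s ∈ XZ.powerset, ∑ t ∈ YZ.powerset,
      (Z (A ∪ g ∪ s) (A ∪ g ∪ s) - Z (A ∪ g ∪ s) (w ∪ (XZ \ s) ∪ (YZ \ t)) - Z (w ∪ (XZ \ s) ∪ (YZ \ t)) (A ∪ g ∪ s)
        + Z (w ∪ (XZ \ s) ∪ (YZ \ t)) (B ∪ h ∪ t)))
    rw [h3]
    have hl01 : ∀ S S' T : Finset ι, S ⊆ S' → Z S (insert e T) ≤ Z S' (insert e T) := fun S S' T hST => hl _ _ _ hST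
    have hr01 : ∀ S T T' : Finset ι, T ⊆ T' → Z S (insert e T) ≤ Z S (insert e T') :=
      fun S T T' hT => hr _ _ _ (Finset.insert_subset_insert e hT)
    have hm01 : ∀ S S' T T' : Finset ι, S ⊆ S' → T ⊆ T' →
        Z S' (insert e T) + Z S (insert e T') ≤ Z S' (insert e T') + Z S (insert e T) :=
      fun S S' T T' hS hT => hm _ _ _ _ hS (Finset.insert_subset_insert e hT)
    have hl10 : ∀ S S' T : Finset ι, S ⊆ S' → Z (insert e S) T ≤ Z (insert e S') T :=
      fun S S' T hST => hl _ _ _ (Finset.insert_subset_insert e hST)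
    have hr10 : ∀ S T T' : Finset ι, T ⊆ T' → Z (insert e S) T ≤ Z (insert e S) T' := fun S T T' hT => hr _ _ _ hT
    have hm10 : ∀ S S' T T' : Finset ι, S ⊆ S' → T ⊆ T' →
        Z (insert e S') T + Z (insert e S) T' ≤ Z (insert e S') T' + Z (insert e S) T :=
      fun S S' T T' hS hT => hm _ _ _ _ (Finset.insert_subset_insert e hS) hT
    have k00 := ih Z hl hr hm A B XZ YZ hYA hXB
    have k01 := ih (fun S T => Z S (insert e T)) hl01 hr01 hm01 A B XZ YZ hYA hXB
    have k10 := ih (fun S T => Z (insert e S) T) hl10 hr10 hm10 A B XZ YZ hYA hXB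
    have ksq : 0 ≤ ∑ g ∈ z₀.powerset, ∑ h ∈ (z₀ \ g).powerset, ∑ s ∈ XZ.powerset, ∑ t ∈ YZ.powerset,
        (Z (insert e (A ∪ g ∪ s)) (insert e (A ∪ g ∪ s)) - Z (insert e (A ∪ g ∪ s)) (A ∪ g ∪ s)
          - Z (A ∪ g ∪ s) (insert e (A ∪ g ∪ s)) + Z (A ∪ g ∪ s) (A ∪ g ∪ s)) := by
      refine Finset.sum_nonneg fun g _ => Finset.sum_nonneg fun h _ =>
        Finset.sum_nonneg fun s _ => Finset.sum_nonneg fun t _ => ?_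
      have := hm (A ∪ g ∪ s) (insert e (A ∪ g ∪ s)) (A ∪ g ∪ s) (insert e (A ∪ g ∪ s))
        (Finset.subset_insert e _) (Finset.subset_insert e _)
      linarith
    have hsplit : ∑ g ∈ z₀.powerset, ∑ h ∈ (z₀ \ g).powerset,
        ((∑ s ∈ XZ.powerset, ∑ t ∈ YZ.powerset,
            (Z (A ∪ insert e g ∪ s) (A ∪ insert e g ∪ s) - Z (A ∪ insert e g ∪ s) ((z₀ \ g) \ h ∪ (XZ \ s) ∪ (YZ \ t))
              - Z ((z₀ \ g) \ h ∪ (XZ \ s) ∪ (YZ \ t)) (A ∪ insert e g ∪ s)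
              + Z ((z₀ \ g) \ h ∪ (XZ \ s) ∪ (YZ \ t)) (B ∪ h ∪ t))) +
          (∑ s ∈ XZ.powerset, ∑ t ∈ YZ.powerset,
            (Z (A ∪ g ∪ s) (A ∪ g ∪ s) - Z (A ∪ g ∪ s) ((z₀ \ g) \ h ∪ (XZ \ s) ∪ (YZ \ t))
              - Z ((z₀ \ g) \ h ∪ (XZ \ s) ∪ (YZ \ t)) (A ∪ g ∪ s)
              + Z ((z₀ \ g) \ h ∪ (XZ \ s) ∪ (YZ \ t)) (B ∪ insert e h ∪ t))) +
          (∑ s ∈ XZ.powerset, ∑ t ∈ YZ.powerset,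
            (Z (A ∪ g ∪ s) (A ∪ g ∪ s) - Z (A ∪ g ∪ s) (insert e ((z₀ \ g) \ h) ∪ (XZ \ s) ∪ (YZ \ t))
              - Z (insert e ((z₀ \ g) \ h) ∪ (XZ \ s) ∪ (YZ \ t)) (A ∪ g ∪ s)
              + Z (insert e ((z₀ \ g) \ h) ∪ (XZ \ s) ∪ (YZ \ t)) (B ∪ h ∪ t)))) =
        (∑ g ∈ z₀.powerset, ∑ h ∈ (z₀ \ g).powerset, ∑ s ∈ XZ.powerset, ∑ t ∈ YZ.powerset,
          (Z (A ∪ g ∪ s) (A ∪ g ∪ s) - Z (A ∪ g ∪ s) ((z₀ \ g) \ h ∪ (XZ \ s) ∪ (YZ \ t))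
            - Z ((z₀ \ g) \ h ∪ (XZ \ s) ∪ (YZ \ t)) (A ∪ g ∪ s)
            + Z ((z₀ \ g) \ h ∪ (XZ \ s) ∪ (YZ \ t)) (B ∪ h ∪ t))) +
        (∑ g ∈ z₀.powerset, ∑ h ∈ (z₀ \ g).powerset, ∑ s ∈ XZ.powerset, ∑ t ∈ YZ.powerset,
          (Z (A ∪ g ∪ s) (insert e (A ∪ g ∪ s)) - Z (A ∪ g ∪ s) (insert e ((z₀ \ g) \ h ∪ (XZ \ s) ∪ (YZ \ t)))
            - Z ((z₀ \ g) \ h ∪ (XZ \ s) ∪ (YZ \ t)) (insert e (A ∪ g ∪ s))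
            + Z ((z₀ \ g) \ h ∪ (XZ \ s) ∪ (YZ \ t)) (insert e (B ∪ h ∪ t)))) +
        (∑ g ∈ z₀.powerset, ∑ h ∈ (z₀ \ g).powerset, ∑ s ∈ XZ.powerset, ∑ t ∈ YZ.powerset,
          (Z (insert e (A ∪ g ∪ s)) (A ∪ g ∪ s) - Z (insert e (A ∪ g ∪ s)) ((z₀ \ g) \ h ∪ (XZ \ s) ∪ (YZ \ t))
            - Z (insert e ((z₀ \ g) \ h ∪ (XZ \ s) ∪ (YZ \ t))) (A ∪ g ∪ s)
            + Z (insert e ((z₀ \ g) \ h ∪ (XZ \ s) ∪ (YZ \ t))) (B ∪ h ∪ t))) +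
        ∑ g ∈ z₀.powerset, ∑ h ∈ (z₀ \ g).powerset, ∑ s ∈ XZ.powerset, ∑ t ∈ YZ.powerset,
          (Z (insert e (A ∪ g ∪ s)) (insert e (A ∪ g ∪ s)) - Z (insert e (A ∪ g ∪ s)) (A ∪ g ∪ s)
            - Z (A ∪ g ∪ s) (insert e (A ∪ g ∪ s)) + Z (A ∪ g ∪ s) (A ∪ g ∪ s)) := by
      rw [← Finset.sum_add_distrib, ← Finset.sum_add_distrib, ← Finset.sum_add_distrib]
      refine Finset.sum_congr rfl fun g _ => ?_
      rw [← Finset.sum_add_distrib, ← Finset.sum_add_distrib, ← Finset.sum_add_distrib]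
      refine Finset.sum_congr rfl fun h _ => ?_
      rw [← Finset.sum_add_distrib, ← Finset.sum_add_distrib, ← Finset.sum_add_distrib,
        ← Finset.sum_add_distrib, ← Finset.sum_add_distrib]
      refine Finset.sum_congr rfl fun s _ => ?_
      rw [← Finset.sum_add_distrib, ← Finset.sum_add_distrib, ← Finset.sum_add_distrib,
        ← Finset.sum_add_distrib, ← Finset.sum_add_distrib]
      refine Finset.sum_congr rfl fun t _ => ?_
      rw [Finset.union_insert, Finset.insert_union, Finset.union_insert, Finset.insert_union,
        Finset.insert_union, Finset.insert_union]
      ring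
    rw [hsplit]
    nlinarith [k00, k01, k10, ksq]

/-! ## THEOREM Π (principal, all twists) -/

/-- **THEOREM Π (principal up-sets of every twisted copy order).**  For `Z : Finset ι → Finset ι → ℤ` monotone in each argument and
2-increasing, and all `A, B, XZ, YZ, z₀` with `YZ ⊆ A`, `XZ ⊆ B`:
`Σ_{(g,h,w) ⊢ z₀} Σ_{s ⊆ XZ} Σ_{t ⊆ YZ} K_Z(A∪g∪s, B∪h∪t, w∪(XZ\s)∪(YZ\t)) ≥ 0`, `K_Z(a,b,c) = 2Z(a,a) + Z(c,b) − Z(c,a) − Z(a,c) − Z(c,c)`.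
In copy coordinates this is the kernel of Conjecture V/W summed over all faces above the face `(A ∪ ·, B ∪ ·)` of the `τ`-twisted copy
order (`z₀` = untwisted free coordinates, `XZ`/`YZ` = twisted coordinates of `b₀∖a₀` / `a₀∖b₀`); `XZ = YZ = ∅` is THEOREM P⊗. [this work] -/
theorem twistedPrincipal_kernelZ_sum_nonneg (Z : Finset ι → Finset ι → ℤ)
    (hl : ∀ S S' T, S ⊆ S' → Z S T ≤ Z S' T) (hr : ∀ S T T', T ⊆ T' → Z S T ≤ Z S T')
    (hm : ∀ S S' T T', S ⊆ S' → T ⊆ T' → Z S' T + Z S T' ≤ Z S' T' + Z S T)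
    (A B XZ YZ z₀ : Finset ι) (hYA : YZ ⊆ A) (hXB : XZ ⊆ B) :
    0 ≤ ∑ g ∈ z₀.powerset, ∑ h ∈ (z₀ \ g).powerset, ∑ s ∈ XZ.powerset, ∑ t ∈ YZ.powerset,
      (2 * Z (A ∪ g ∪ s) (A ∪ g ∪ s) + Z (((z₀ \ g) \ h) ∪ (XZ \ s) ∪ (YZ \ t)) (B ∪ h ∪ t)
        - Z (((z₀ \ g) \ h) ∪ (XZ \ s) ∪ (YZ \ t)) (A ∪ g ∪ s) - Z (A ∪ g ∪ s) (((z₀ \ g) \ h) ∪ (XZ \ s) ∪ (YZ \ t))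
        - Z (((z₀ \ g) \ h) ∪ (XZ \ s) ∪ (YZ \ t)) (((z₀ \ g) \ h) ∪ (XZ \ s) ∪ (YZ \ t))) := by
  have hA := twistedPrincipal_alpha_nonneg z₀ Z hl hr A XZ YZ hYA
  have hB := twistedPrincipal_beta_nonneg z₀ Z hl hr hm A B XZ YZ hYA hXB
  have hsplit : ∑ g ∈ z₀.powerset, ∑ h ∈ (z₀ \ g).powerset, ∑ s ∈ XZ.powerset, ∑ t ∈ YZ.powerset,
      (2 * Z (A ∪ g ∪ s) (A ∪ g ∪ s) + Z (((z₀ \ g) \ h) ∪ (XZ \ s) ∪ (YZ \ t)) (B ∪ h ∪ t)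
        - Z (((z₀ \ g) \ h) ∪ (XZ \ s) ∪ (YZ \ t)) (A ∪ g ∪ s) - Z (A ∪ g ∪ s) (((z₀ \ g) \ h) ∪ (XZ \ s) ∪ (YZ \ t))
        - Z (((z₀ \ g) \ h) ∪ (XZ \ s) ∪ (YZ \ t)) (((z₀ \ g) \ h) ∪ (XZ \ s) ∪ (YZ \ t))) =
      (∑ g ∈ z₀.powerset, ∑ h ∈ (z₀ \ g).powerset, ∑ s ∈ XZ.powerset, ∑ t ∈ YZ.powerset,
        (Z (A ∪ g ∪ s) (A ∪ g ∪ s)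
          - Z (((z₀ \ g) \ h) ∪ (XZ \ s) ∪ (YZ \ t)) (((z₀ \ g) \ h) ∪ (XZ \ s) ∪ (YZ \ t)))) +
      ∑ g ∈ z₀.powerset, ∑ h ∈ (z₀ \ g).powerset, ∑ s ∈ XZ.powerset, ∑ t ∈ YZ.powerset,
        (Z (A ∪ g ∪ s) (A ∪ g ∪ s) - Z (A ∪ g ∪ s) (((z₀ \ g) \ h) ∪ (XZ \ s) ∪ (YZ \ t))
          - Z (((z₀ \ g) \ h) ∪ (XZ \ s) ∪ (YZ \ t)) (A ∪ g ∪ s)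
          + Z (((z₀ \ g) \ h) ∪ (XZ \ s) ∪ (YZ \ t)) (B ∪ h ∪ t)) := by
    rw [← Finset.sum_add_distrib]
    refine Finset.sum_congr rfl fun g _ => ?_
    rw [← Finset.sum_add_distrib]
    refine Finset.sum_congr rfl fun h _ => ?_
    rw [← Finset.sum_add_distrib]
    refine Finset.sum_congr rfl fun s _ => ?_
    rw [← Finset.sum_add_distrib]
    refine Finset.sum_congr rfl fun t _ => ?_
    ring
  rw [hsplit]
  exact add_nonneg hA hB

end Summit.CriticalPhenomena.PercolationContinuityZ3.Theorems.ThreePartition
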